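import Summits.BirchSwinnertonDyer.Rank1Residual.Additive.TameBranchExtraZerosRankZero
import HarnessLib

/-!
# THE EXTRA ZEROS' CONTRIBUTION at RANK ZERO on defect 3, 4, 6 — FROM PRINT + ONE VALUATION
# `ord_p[0]⁺_f` (the inequality) + TWO VALUES (the equality criterion `λ(X) = λ_an`, type-free)
# (cell `b2b-bsdres`, sub-cell additive-p2 = X3♯(G-ord)/X4♯(G-ord), gen 29; part 5)

HONEST FRAMING (cell `b2b-bsdres`, run/shared/lean/b2b/bsd-rank1-residual/, verbatim in every
file): the goal of the cell is to DELETE the COMBINATION-SHAPED residual classes of the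
Birch–Swinnerton-Dyer formula for ALL analytic-rank `≤ 1` elliptic curves over `ℚ` — "full BSD
formula for every rank `≤ 1` curve in class `C`" assembled STRICTLY from published theorems — so
that the rank-`≤ 1` remainder becomes exactly the CONSTRUCTION-SHAPED classes, which are TYPED
(missing-input `Prop`s), NOT attempted. This is not "finishing BSD". Sub-cell additive-p2: the
classes X3♯(G-ord) / X4♯(G-ord) are CONSTRUCTION-SHAPED and stay so; labels / RESIDUAL-MAP marks
UNCHANGED; nothing is booked. Theorems only; the named facts enter as hypothesis binders
(`Delbourgo1998.thm1_exists_bounded_evenMeasure` A282, `Delbourgo2002.mainTheorem` A175,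
`Delbourgo2002.thmC_charIdeal_dvd_tameBranch` A227, `Delbourgo2002.mainTheorem_potMult`). No
definition, no `sorry`.

## What and why

Part 4 proved, for ANY tuple of the tame-branch package with `[0]⁺_f ≠ 0` at rank zero, the inequality
`ord Ш[p^∞] + ord Reg_p + ord ∏c + ord ℓ ≤ μ(fE) + ord_p[0]⁺_f + c + 2 ord #tors` and the criterion
"`=` iff `λ(fE) =` the first top index of `B`". Here the tuple comes from PRINT (Delbourgo 1998 Thm 1,
`exists_isTameBranchOf_of_thm1`: `(χ₀, ã₀, B)` with `χ₀ ∈ {ω^u, ω^{−u}}` undecided) and the first top from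
the census's TWO values, TYPE-FREE:

* §9 **`exists_isTameBranchOf_pow_firstTop_of_thm1_of_two_norm_ratTwistedSymbolSum`** — two values on ONE
  line `t ∈ {1, e−1}` with common `k`, `e·k < 2φₙ` ⟹ a witness of `ι∘χ^t` (`χ = ω^u`) with the tower bounds
  inherited and FIRST top at `k` EXISTS (`t = 1`: gen 27's certificate, the conjugate refuted at the next
  conductor; `t = e−1`: gen 28's `…_inv_succ`) — the witness-currency form of gen 28's type-free sign;
* **`padicVal_le_rankZero_of_thm1`** / **`ClassX4Gord.padicVal_le_rankZero_of_thm1`** — the INEQUALITY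
  from PRINT + the one rational number `[0]⁺_f` (no twisted value: the branch EXISTS by Thm 1, its sign is
  irrelevant);
* **`padicVal_le_rankZero_of_thm1_of_two_norm_ratTwistedSymbolSum`** (general locus) and
  **`ClassX4Gord.padicVal_le_rankZero_of_thm1_of_two_norm_ratTwistedSymbolSum`** (`c = 0` by Drinfeld–Manin):
  `#Ш[p^∞] < ∞`, `λ(fE) ≤ k`, the inequality, and `=` iff `λ(fE) = k`.

READING for the census (EVIDENCE, not an input): on X4-3 (rank 0) the per-pair data are `ord_p[0]⁺_f`
(one rational number) and, for the criterion, the (p², p³) pair of gen 28 (R0X: `k = λ_an = 2` on eight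
rows, `4` on 7350ca1@5 at (p³, p⁴)). Where `#Ш_an·∏c/#tors² = [0]⁺_f` up to `p`-units — an optimal
curve with Manin constant `1` and `c_∞ ∈ {1,2}` (true on those nine rows, Cremona's range; in general the
period/Manin binder of gens 14–17) — the equality case under `Ш ↔ Ш_an`, `ℓ = 1`, `μ = 0` is AUTOMATIC,
so at those nine pairs `BSD(E,p) ∧ μ(X) = 0` is EQUIVALENT to the λ-part `λ(X(E/ℚ_∞)) = λ_an ∈ {2, 4}`
(extra algebraic zeros at rank zero). Nothing booked; labels UNCHANGED.

Not claimed: `μ`; the UPPER or LOWER half as theorems; any booking.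

References: [Delbourgo1998] Thm. 1; [Delbourgo2002] Thm. (A)(B)(C); [Lang1990] Ch. 1 §2 Thm. 2.1;
[MazurTateTeitelbaum1986Invent] §I.8, §I.13–I.14; [Manin1972]; [Washington1997] §7.1. -/

set_option autoImplicit false

noncomputable section

open scoped Classical MatrixGroups ModularForm NumberField

open CongruenceSubgroup IsDedekindDomain WeierstrassCurve NumberField
  Literature.NumberTheory.EllipticCurves
  Literature.NumberTheory.EllipticCurves.ModularForms
  Literature.NumberTheory.EllipticCurves.Rank1Residual
  Literature.NumberTheory.EllipticCurves.Rank1Residual.Typed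
  Literature.NumberTheory.EllipticCurves.Delbourgo2002
  Summit.BirchSwinnertonDyer.Rank1Residual.X1.MuLambda
  Summit.BirchSwinnertonDyer.Rank1Residual.X1.RankOneParitySqueeze
  Summit.BirchSwinnertonDyer.Rank1Residual.X11a.LambdaNorm

namespace Summit.BirchSwinnertonDyer.Rank1Residual.Additive

/-! ### §9 Rank zero on defect 3, 4, 6 from PRINT: the inequality from ONE valuation `ord_p[0]⁺_f`,
the equality criterion from TWO values (type-free) -/

namespace TwistPartner

open TameBranchOneValue TameBranchTwoValue TameBranchExtraZeros

section ZeroJoin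

variable {W : WeierstrassCurve ℚ} [W.IsElliptic] [W.IsGloballyMinimal] {p : ℕ} [hp : Fact p.Prime]
  {N : ℕ} [NeZero N] {f : CuspForm (Gamma0 N) 2} {χ : MulChar (ZMod p) ℚ_[p]}

/-- **A TYPE-FREE WITNESS WITH FIRST TOP `k` (Delbourgo 1998 Thm 1 + TWO values).** `p ≥ 5`, ADDITIVE,
(G)-ordinary, `e ∈ {3,4,6}`, newform `f`, `χ = ω^u` of order `e`, tower bound `p^c`, two even primitive
`p`-power-order characters at consecutive conductors with values on ONE line `t ∈ {1, e−1}`, common `k`,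
`e·k < 2φₙ` ⟹ there are `ã₀` (`‖ã₀‖ = 1`) and `B` with `IsTameBranchOf f p (ι∘χ^t) ã₀ B`, every tower
bound inherited, and FIRST top coefficient at `k`. (`t = 1`: gen 27's certificate or gen 28's refutation at
the next conductor; `t = e−1`: gen 28's `…_inv_succ`.) Nothing booked. [cite: Delbourgo1998, Theorem 1 (p. 131)]
[cite: Lang1990, Ch. 1 §2 Thm. 2.1] [cite: MazurTateTeitelbaum1986Invent, §I.8, §I.13–I.14] -/
theorem exists_isTameBranchOf_pow_firstTop_of_thm1_of_two_norm_ratTwistedSymbolSum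
    (hD : Delbourgo1998.thm1_exists_bounded_evenMeasure) (h5 : 5 ≤ p) (hadd : Addv W p)
    (hGord : TypeGOrd W p) (he : semistabilityIndex W p ∈ ({3, 4, 6} : Finset ℕ))
    (hf : IsNewformOf W f) (hχe : orderOf χ = semistabilityIndex W p) {u : ℕ}
    (hu : semistabilityIndex W p * u = p - 1)
    (hteich : ∀ a : ZMod p, a ≠ 0 → ‖χ a - ((a.val : ℕ) : ℚ_[p]) ^ u‖ < 1) {c : ℕ}
    (hc : ∀ (m : ℕ) (a : ℤ), ‖((ratPlusSymbol f ((a : ℚ) / (p : ℚ) ^ m) : ℚ) : ℚ_[p])‖ ≤ (p : ℝ) ^ c)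
    {n : ℕ} {κ : DirichletCharacter ℂ_[p] (p ^ (n + 1 + cyclotomicExponent p))} (hκ : κ.IsPrimitive)
    (heven : κ.Even) (hord : ∃ j : ℕ, orderOf κ = p ^ j)
    {κ' : DirichletCharacter ℂ_[p] (p ^ (n + 1 + 1 + cyclotomicExponent p))} (hκ' : κ'.IsPrimitive)
    (heven' : κ'.Even) (hord' : ∃ j : ℕ, orderOf κ' = p ^ j) {k t : ℕ}
    (ht : t = 1 ∨ t = semistabilityIndex W p - 1)
    (hk2 : semistabilityIndex W p * k < 2 * Nat.totient (p ^ (n + 1)))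
    (hval : ‖ratTwistedSymbolSum f κ‖ ^ (semistabilityIndex W p * Nat.totient (p ^ (n + 1))) =
      ((p : ℝ) ^ c) ^ (semistabilityIndex W p * Nat.totient (p ^ (n + 1))) *
        ((p : ℝ)⁻¹) ^ (semistabilityIndex W p * k + t * Nat.totient (p ^ (n + 1))))
    (hval' : ‖ratTwistedSymbolSum f κ'‖ ^ (semistabilityIndex W p * Nat.totient (p ^ (n + 1 + 1))) =
      ((p : ℝ) ^ c) ^ (semistabilityIndex W p * Nat.totient (p ^ (n + 1 + 1))) *
        ((p : ℝ)⁻¹) ^ (semistabilityIndex W p * k + t * Nat.totient (p ^ (n + 1 + 1)))) :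
    ∃ (ã₀ : ℚ_[p]) (B : PowerSeries ℚ_[p]), ‖ã₀‖ = 1 ∧
      IsTameBranchOf f p ((χ ^ t).ringHomComp (algebraMap ℚ_[p] ℂ_[p])) ã₀ B ∧
      (∀ C : ℝ, (∀ (m : ℕ) (a : ℤ), ‖((ratPlusSymbol f ((a : ℚ) / (p : ℚ) ^ m) : ℚ) : ℚ_[p])‖ ≤ C) →
        ∀ j : ℕ, ‖PowerSeries.coeff j B‖ ≤ C) ∧
      ‖PowerSeries.coeff k B‖ = (p : ℝ) ^ c ∧ ∀ i < k, ‖PowerSeries.coeff i B‖ < (p : ℝ) ^ c := by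
  have hp2 : p ≠ 2 := by omega
  have h3 : 3 ≤ semistabilityIndex W p := three_le_of_mem he
  have h2 : 2 ≤ semistabilityIndex W p := by omega
  have hG : SubGord W p := (subGord_iff_typeG_of_addv W p hp2 hadd).mpr hGord.typeG
  rcases ht with rfl | rfl
  · rw [one_mul] at hval hval'
    rw [pow_one]
    obtain ⟨χ₀, ã₀, B, hord0, hã₀, hB, hint⟩ := exists_isTameBranchOf_of_thm1 hD h5 hadd hGord he hf
    have hbd : ∀ j : ℕ, ‖PowerSeries.coeff j B‖ ≤ (p : ℝ) ^ c := hint _ hc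
    have hkφ : k < Nat.totient (p ^ (n + 1)) := lt_of_mul_lt_two_mul h2 hk2
    have hord0' : orderOf χ₀ = semistabilityIndex W p := by
      have h := hord0
      rwa [orderOf_ringHomComp_padicComplex, tameDefect_of_not_potMult W p hG.1] at h
    rcases eq_or_eq_inv_of_orderOf_eq he hχe hord0' with h0 | h0
    · subst h0
      exact ⟨ã₀, B, hã₀, hB, hint, hB.firstTop_of_norm_ratTwistedSymbolSum_pow_eq hã₀ hbd hteich hχe h2 hu
        hκ heven hord hkφ hval⟩
    · exfalso
      subst h0
      exact hB.false_of_norm_ratTwistedSymbolSum_pow_eq_inv_succ hã₀ hbd hteich hχe h3 hu hκ' heven'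
        hord' hk2 hval'
  · rw [pow_sub_one_eq_inv_of_orderOf hχe (by omega)]
    exact exists_isTameBranchOf_inv_firstTop_of_thm1_of_norm_ratTwistedSymbolSum_inv_succ hD h5 hadd hGord
      he hf hχe hu hteich hc hκ heven hord hκ' heven' hord' hk2 hval hval'

/-- **RANK ZERO FROM PRINT + ONE RATIONAL NUMBER — the inequality, no twisted value.** `p ≥ 5`,
non-CM, ADDITIVE, (G)-ordinary, `e ∈ {3,4,6}`, `rank_ℤ E(ℚ) = 0`; Delbourgo 1998 Thm 1 (the branch EXISTS,
sign irrelevant), 2002 (A)(B)(C); tower bound `p^c`; `[0]⁺_f ≠ 0`. Then for every (B)-datum and every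
cyclotomic dual datum with generator `fE`: `#Ш[p^∞] < ∞` and
**`ord_p #Ш[p^∞] + ord_p Reg_p + ord_p ∏c + ord_p ℓ ≤ μ(fE) + ord_p[0]⁺_f + c + 2 ord_p #tors`**.
[cite: Delbourgo1998, Theorem 1 (p. 131)] [cite: Delbourgo2002, Theorem (A), (B), (C) (p. 40)]
[cite: Washington1997, §7.1] -/
theorem padicVal_le_rankZero_of_thm1 (hD : Delbourgo1998.thm1_exists_bounded_evenMeasure)
    (hC : Delbourgo2002.thmC_charIdeal_dvd_tameBranch) (hDel : Delbourgo2002.mainTheorem)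
    (hDelM : Delbourgo2002.mainTheorem_potMult) (h5 : 5 ≤ p) (hcm : ¬ W.HasCM) (hadd : Addv W p)
    (hGord : TypeGOrd W p) (he : semistabilityIndex W p ∈ ({3, 4, 6} : Finset ℕ))
    (hr0 : W.mordellWeilRank = 0) (hf : IsNewformOf W f) {c : ℕ}
    (hc : ∀ (m : ℕ) (a : ℤ), ‖((ratPlusSymbol f ((a : ℚ) / (p : ℚ) ^ m) : ℚ) : ℚ_[p])‖ ≤ (p : ℝ) ^ c)
    (h0 : ratPlusSymbol f 0 ≠ 0) {Dh : PAdicHeightData W p} (hBcl : LeadingTermClauses W p Dh)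
    {K : ZpExtension ℚ p} {γ : Field.absoluteGaloisGroup ℚ}
    (hK : K.IsCyclotomic) (hγ : K.IsTopGenerator γ) (hcv : IsCyclotomicVariable p γ)
    (D : W.SelmerDualData K γ) [Module.Finite (IwasawaAlgebra p) D.X]
    {fE : IwasawaAlgebra p} (hchar : D.charIdeal = Ideal.span {fE}) :
    Finite (AddCommGroup.primaryComponent W.sha p) ∧
      ∃ ℓ : ℕ, ℓ ∣ p ^ 2 ∧ (ReductionNonAnomalous W p → ℓ = 1) ∧
        (padicValNat p (Nat.card (AddCommGroup.primaryComponent W.sha p)) : ℤ) +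
            (padicRegulator Dh).valuation + padicValNat p W.tamagawaProduct + padicValNat p ℓ ≤
          X1.MuLambda.mu fE + padicValRat p (ratPlusSymbol f 0) + c + 2 * padicValNat p W.torsionOrder := by
  have hp2 : p ≠ 2 := by omega
  have hT : TameBranchRatDvdAt W p := tameBranchRatDvdAt_of_thmC hC hDel hDelM h5 hcm
  obtain ⟨χ₀, ã₀, B, hord0, hã₀, hB, hint⟩ := exists_isTameBranchOf_of_thm1 hD h5 hadd hGord he hf
  obtain ⟨-, hfin, ℓ, hℓ, hna, hle, -⟩ := schneider_and_padicVal_le_rankZero_of_tameBranchRatDvdAt hT hp2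
    hadd (Or.inr hGord) hf hord0 hã₀ hB (hint _ hc) h0 hr0 hBcl hK hγ hcv D hchar
  exact ⟨hfin, ℓ, hℓ, hna, hle⟩

/-- **X4♯(G-ord), defect 3, 4, 6, `rank_ℤ E(ℚ) = 0`, `p ≥ 5`, non-CM — FROM PRINT + `ord_p[0]⁺_f` ALONE**
(Drinfeld–Manin `c = 0`): for every (B)-datum and every cyclotomic dual datum with generator `fE`:
`#Ш[p^∞] < ∞` and **`ord_p #Ш[p^∞] + ord_p Reg_p + ord_p ∏c + ord_p ℓ ≤ μ(fE) + ord_p[0]⁺_f + 2 ord_p #tors`**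
— the rank-zero leading-term inequality on EVERY X4-3 row from one rational number; with `μ = 0`,
`ℓ = 1` it reads `ord_p #Ш ≤ ord_p([0]⁺_f·#tors²/∏c)`. Nothing booked; X4♯(G-ord) CONSTRUCTION-SHAPED.
[cite: Delbourgo1998, Theorem 1 (p. 131)] [cite: Delbourgo2002, Theorem (A), (B), (C) (p. 40)]
[cite: Manin1972, Cor. 3.6] [cite: Washington1997, §7.1] -/
theorem ClassX4Gord.padicVal_le_rankZero_of_thm1 (hD : Delbourgo1998.thm1_exists_bounded_evenMeasure)
    (hC : Delbourgo2002.thmC_charIdeal_dvd_tameBranch) (hDel : Delbourgo2002.mainTheorem)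
    (hDelM : Delbourgo2002.mainTheorem_potMult) (hX : ClassX4Gord W p) (h5 : 5 ≤ p) (hcm : ¬ W.HasCM)
    (he : semistabilityIndex W p ∈ ({3, 4, 6} : Finset ℕ)) (hr0 : W.mordellWeilRank = 0)
    (hf : IsNewformOf W f) (h0 : ratPlusSymbol f 0 ≠ 0)
    {Dh : PAdicHeightData W p} (hBcl : LeadingTermClauses W p Dh)
    {K : ZpExtension ℚ p} {γ : Field.absoluteGaloisGroup ℚ}
    (hK : K.IsCyclotomic) (hγ : K.IsTopGenerator γ) (hcv : IsCyclotomicVariable p γ)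
    (D : W.SelmerDualData K γ) [Module.Finite (IwasawaAlgebra p) D.X]
    {fE : IwasawaAlgebra p} (hchar : D.charIdeal = Ideal.span {fE}) :
    Finite (AddCommGroup.primaryComponent W.sha p) ∧
      ∃ ℓ : ℕ, ℓ ∣ p ^ 2 ∧ (ReductionNonAnomalous W p → ℓ = 1) ∧
        (padicValNat p (Nat.card (AddCommGroup.primaryComponent W.sha p)) : ℤ) +
            (padicRegulator Dh).valuation + padicValNat p W.tamagawaProduct + padicValNat p ℓ ≤
          X1.MuLambda.mu fE + padicValRat p (ratPlusSymbol f 0) + 2 * padicValNat p W.torsionOrder := by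
  have hc : ∀ (m : ℕ) (a : ℤ),
      ‖((ratPlusSymbol f ((a : ℚ) / (p : ℚ) ^ m) : ℚ) : ℚ_[p])‖ ≤ (p : ℝ) ^ (0 : ℕ) := fun m a ↦ by
    rw [pow_zero]
    exact plusSymbolsPIntegralAt_of_classX4 W p hX.1 f hf _
  have h := TwistPartner.padicVal_le_rankZero_of_thm1 hD hC hDel hDelM h5 hcm hX.addv.2 hX.typeGOrd he hr0 hf
    hc h0 hBcl hK hγ hcv D hchar
  simp only [Nat.cast_zero, add_zero] at h
  exact h

/-- **RANK ZERO FROM PRINT + ONE VALUATION (inequality) + TWO VALUES (equality criterion).** `p ≥ 5`,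
non-CM, ADDITIVE, (G)-ordinary, `e ∈ {3,4,6}`, `rank_ℤ E(ℚ) = 0`; Delbourgo 1998 Thm 1, 2002 (A)(B)(C);
tower bound `p^c`; `[0]⁺_f ≠ 0`; for the equality clause, `χ = ω^u` and TWO values on one line
`t ∈ {1, e−1}` with common `k`, `e·k < 2φₙ`. Then for every (B)-datum and every cyclotomic dual datum with
generator `fE`: `#Ш[p^∞] < ∞`, `λ(fE) ≤ k`,
**`ord_p #Ш[p^∞] + ord_p Reg_p + ord_p ∏c + ord_p ℓ ≤ μ(fE) + ord_p[0]⁺_f + c + 2 ord_p #tors`, `=` iff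
`λ(fE) = k`**. NO unit root, (G)-field, forced partner, sign certificate or Riemann sum. Nothing booked.
[cite: Delbourgo1998, Theorem 1 (p. 131)] [cite: Delbourgo2002, Theorem (A), (B), (C) (p. 40)]
[cite: Lang1990, Ch. 1 §2 Thm. 2.1] [cite: Washington1997, §7.1] -/
theorem padicVal_le_rankZero_of_thm1_of_two_norm_ratTwistedSymbolSum
    (hD : Delbourgo1998.thm1_exists_bounded_evenMeasure)
    (hC : Delbourgo2002.thmC_charIdeal_dvd_tameBranch) (hDel : Delbourgo2002.mainTheorem)
    (hDelM : Delbourgo2002.mainTheorem_potMult) (h5 : 5 ≤ p) (hcm : ¬ W.HasCM) (hadd : Addv W p)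
    (hGord : TypeGOrd W p) (he : semistabilityIndex W p ∈ ({3, 4, 6} : Finset ℕ))
    (hr0 : W.mordellWeilRank = 0) (hf : IsNewformOf W f) (hχe : orderOf χ = semistabilityIndex W p)
    {u : ℕ} (hu : semistabilityIndex W p * u = p - 1)
    (hteich : ∀ a : ZMod p, a ≠ 0 → ‖χ a - ((a.val : ℕ) : ℚ_[p]) ^ u‖ < 1) {c : ℕ}
    (hc : ∀ (m : ℕ) (a : ℤ), ‖((ratPlusSymbol f ((a : ℚ) / (p : ℚ) ^ m) : ℚ) : ℚ_[p])‖ ≤ (p : ℝ) ^ c)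
    (h0 : ratPlusSymbol f 0 ≠ 0)
    {n : ℕ} {κ : DirichletCharacter ℂ_[p] (p ^ (n + 1 + cyclotomicExponent p))} (hκ : κ.IsPrimitive)
    (heven : κ.Even) (hord : ∃ j : ℕ, orderOf κ = p ^ j)
    {κ' : DirichletCharacter ℂ_[p] (p ^ (n + 1 + 1 + cyclotomicExponent p))} (hκ' : κ'.IsPrimitive)
    (heven' : κ'.Even) (hord' : ∃ j : ℕ, orderOf κ' = p ^ j) {k t : ℕ}
    (ht : t = 1 ∨ t = semistabilityIndex W p - 1)
    (hk2 : semistabilityIndex W p * k < 2 * Nat.totient (p ^ (n + 1)))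
    (hval : ‖ratTwistedSymbolSum f κ‖ ^ (semistabilityIndex W p * Nat.totient (p ^ (n + 1))) =
      ((p : ℝ) ^ c) ^ (semistabilityIndex W p * Nat.totient (p ^ (n + 1))) *
        ((p : ℝ)⁻¹) ^ (semistabilityIndex W p * k + t * Nat.totient (p ^ (n + 1))))
    (hval' : ‖ratTwistedSymbolSum f κ'‖ ^ (semistabilityIndex W p * Nat.totient (p ^ (n + 1 + 1))) =
      ((p : ℝ) ^ c) ^ (semistabilityIndex W p * Nat.totient (p ^ (n + 1 + 1))) *
        ((p : ℝ)⁻¹) ^ (semistabilityIndex W p * k + t * Nat.totient (p ^ (n + 1 + 1))))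
    {Dh : PAdicHeightData W p} (hBcl : LeadingTermClauses W p Dh)
    {K : ZpExtension ℚ p} {γ : Field.absoluteGaloisGroup ℚ}
    (hK : K.IsCyclotomic) (hγ : K.IsTopGenerator γ) (hcv : IsCyclotomicVariable p γ)
    (D : W.SelmerDualData K γ) [Module.Finite (IwasawaAlgebra p) D.X]
    {fE : IwasawaAlgebra p} (hchar : D.charIdeal = Ideal.span {fE}) :
    Finite (AddCommGroup.primaryComponent W.sha p) ∧ X1.MuLambda.lam fE ≤ k ∧
      ∃ ℓ : ℕ, ℓ ∣ p ^ 2 ∧ (ReductionNonAnomalous W p → ℓ = 1) ∧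
        (padicValNat p (Nat.card (AddCommGroup.primaryComponent W.sha p)) : ℤ) +
            (padicRegulator Dh).valuation + padicValNat p W.tamagawaProduct + padicValNat p ℓ ≤
          X1.MuLambda.mu fE + padicValRat p (ratPlusSymbol f 0) + c + 2 * padicValNat p W.torsionOrder ∧
        ((padicValNat p (Nat.card (AddCommGroup.primaryComponent W.sha p)) : ℤ) +
            (padicRegulator Dh).valuation + padicValNat p W.tamagawaProduct + padicValNat p ℓ =
          X1.MuLambda.mu fE + padicValRat p (ratPlusSymbol f 0) + c + 2 * padicValNat p W.torsionOrder ↔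
          X1.MuLambda.lam fE = k) := by
  have hp2 : p ≠ 2 := by omega
  have hG : SubGord W p := (subGord_iff_typeG_of_addv W p hp2 hadd).mpr hGord.typeG
  have hT : TameBranchRatDvdAt W p := tameBranchRatDvdAt_of_thmC hC hDel hDelM h5 hcm
  obtain ⟨ã₀, B, hã₀, hB, hint, hk, hlt⟩ :=
    exists_isTameBranchOf_pow_firstTop_of_thm1_of_two_norm_ratTwistedSymbolSum hD h5 hadd hGord he hf hχe hu
      hteich hc hκ heven hord hκ' heven' hord' ht hk2 hval hval'
  have hbd : ∀ j : ℕ, ‖PowerSeries.coeff j B‖ ≤ (p : ℝ) ^ c := hint _ hc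
  have hordt : orderOf (χ ^ t) = semistabilityIndex W p :=
    orderOf_pow_eq_of_mem hχe (by have := three_le_of_mem he; omega) ht
  have hordε : orderOf ((χ ^ t).ringHomComp (algebraMap ℚ_[p] ℂ_[p])) = tameDefect W p := by
    rw [orderOf_ringHomComp_padicComplex, hordt, tameDefect_of_not_potMult W p hG.1]
  obtain ⟨-, hfin, ℓ, hℓ, hna, hle, hcrit⟩ := schneider_and_padicVal_le_rankZero_of_tameBranchRatDvdAt hT
    hp2 hadd (Or.inr hGord) hf hordε hã₀ hB hbd h0 hr0 hBcl hK hγ hcv D hchar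
  obtain ⟨hlam, hiff⟩ := hcrit k hk hlt
  exact ⟨hfin, hlam, ℓ, hℓ, hna, hle, hiff⟩

/-- **X4♯(G-ord), defect 3, 4, 6, `rank_ℤ E(ℚ) = 0`, `p ≥ 5`, non-CM — RANK ZERO: THE INEQUALITY FROM
PRINT + `ord_p[0]⁺_f`, THE EQUALITY CRITERION FROM TWO VALUES** (Drinfeld–Manin `c = 0`): for every
(B)-datum and every cyclotomic dual datum with generator `fE`: `#Ш[p^∞] < ∞`, `λ(fE) ≤ k`, and
**`ord_p #Ш[p^∞] + ord_p Reg_p + ord_p ∏c + ord_p ℓ ≤ μ(fE) + ord_p[0]⁺_f + 2 ord_p #tors`, `=` iff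
`λ(fE) = k`** (`ord_p Reg_p = 0` in rank `0`). On the nine X4-3 window rows with `p ∣ [0]⁺_f` (gen 27 (R2),
gen 28 R0X: `λ_an = 2` ×8, `4` on 7350ca1@5) this is the first kernel statement; on the unit rows
(`k = 0`) it is gen 26's identity. Nothing booked; X4♯(G-ord) stays CONSTRUCTION-SHAPED.
[cite: Delbourgo1998, Theorem 1 (p. 131)] [cite: Delbourgo2002, Theorem (A), (B), (C) (p. 40)]
[cite: Manin1972, Cor. 3.6] [cite: Lang1990, Ch. 1 §2 Thm. 2.1] [cite: Washington1997, §7.1] -/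
theorem ClassX4Gord.padicVal_le_rankZero_of_thm1_of_two_norm_ratTwistedSymbolSum
    (hD : Delbourgo1998.thm1_exists_bounded_evenMeasure)
    (hC : Delbourgo2002.thmC_charIdeal_dvd_tameBranch) (hDel : Delbourgo2002.mainTheorem)
    (hDelM : Delbourgo2002.mainTheorem_potMult) (hX : ClassX4Gord W p) (h5 : 5 ≤ p) (hcm : ¬ W.HasCM)
    (he : semistabilityIndex W p ∈ ({3, 4, 6} : Finset ℕ)) (hr0 : W.mordellWeilRank = 0)
    (hf : IsNewformOf W f) (hχe : orderOf χ = semistabilityIndex W p) {u : ℕ}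
    (hu : semistabilityIndex W p * u = p - 1)
    (hteich : ∀ a : ZMod p, a ≠ 0 → ‖χ a - ((a.val : ℕ) : ℚ_[p]) ^ u‖ < 1)
    (h0 : ratPlusSymbol f 0 ≠ 0)
    {n : ℕ} {κ : DirichletCharacter ℂ_[p] (p ^ (n + 1 + cyclotomicExponent p))} (hκ : κ.IsPrimitive)
    (heven : κ.Even) (hord : ∃ j : ℕ, orderOf κ = p ^ j)
    {κ' : DirichletCharacter ℂ_[p] (p ^ (n + 1 + 1 + cyclotomicExponent p))} (hκ' : κ'.IsPrimitive)
    (heven' : κ'.Even) (hord' : ∃ j : ℕ, orderOf κ' = p ^ j) {k t : ℕ}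
    (ht : t = 1 ∨ t = semistabilityIndex W p - 1)
    (hk2 : semistabilityIndex W p * k < 2 * Nat.totient (p ^ (n + 1)))
    (hval : ‖ratTwistedSymbolSum f κ‖ ^ (semistabilityIndex W p * Nat.totient (p ^ (n + 1))) =
      ((p : ℝ)⁻¹) ^ (semistabilityIndex W p * k + t * Nat.totient (p ^ (n + 1))))
    (hval' : ‖ratTwistedSymbolSum f κ'‖ ^ (semistabilityIndex W p * Nat.totient (p ^ (n + 1 + 1))) =
      ((p : ℝ)⁻¹) ^ (semistabilityIndex W p * k + t * Nat.totient (p ^ (n + 1 + 1))))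
    {Dh : PAdicHeightData W p} (hBcl : LeadingTermClauses W p Dh)
    {K : ZpExtension ℚ p} {γ : Field.absoluteGaloisGroup ℚ}
    (hK : K.IsCyclotomic) (hγ : K.IsTopGenerator γ) (hcv : IsCyclotomicVariable p γ)
    (D : W.SelmerDualData K γ) [Module.Finite (IwasawaAlgebra p) D.X]
    {fE : IwasawaAlgebra p} (hchar : D.charIdeal = Ideal.span {fE}) :
    Finite (AddCommGroup.primaryComponent W.sha p) ∧ X1.MuLambda.lam fE ≤ k ∧
      ∃ ℓ : ℕ, ℓ ∣ p ^ 2 ∧ (ReductionNonAnomalous W p → ℓ = 1) ∧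
        (padicValNat p (Nat.card (AddCommGroup.primaryComponent W.sha p)) : ℤ) +
            (padicRegulator Dh).valuation + padicValNat p W.tamagawaProduct + padicValNat p ℓ ≤
          X1.MuLambda.mu fE + padicValRat p (ratPlusSymbol f 0) + 2 * padicValNat p W.torsionOrder ∧
        ((padicValNat p (Nat.card (AddCommGroup.primaryComponent W.sha p)) : ℤ) +
            (padicRegulator Dh).valuation + padicValNat p W.tamagawaProduct + padicValNat p ℓ =
          X1.MuLambda.mu fE + padicValRat p (ratPlusSymbol f 0) + 2 * padicValNat p W.torsionOrder ↔
          X1.MuLambda.lam fE = k) := by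
  have hc : ∀ (m : ℕ) (a : ℤ),
      ‖((ratPlusSymbol f ((a : ℚ) / (p : ℚ) ^ m) : ℚ) : ℚ_[p])‖ ≤ (p : ℝ) ^ (0 : ℕ) := fun m a ↦ by
    rw [pow_zero]
    exact plusSymbolsPIntegralAt_of_classX4 W p hX.1 f hf _
  have h := TwistPartner.padicVal_le_rankZero_of_thm1_of_two_norm_ratTwistedSymbolSum hD hC hDel hDelM h5
    hcm hX.addv.2 hX.typeGOrd he hr0 hf hχe hu hteich hc h0 hκ heven hord hκ' heven' hord' ht hk2
    (by rw [pow_zero, one_pow, one_mul]; exact hval) (by rw [pow_zero, one_pow, one_mul]; exact hval')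
    hBcl hK hγ hcv D hchar
  simp only [Nat.cast_zero, add_zero] at h
  exact h

end ZeroJoin

end TwistPartner

end Summit.BirchSwinnertonDyer.Rank1Residual.Additive

end
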